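import Literature.AlgebraicGeometry.Resolution.KangarooAtlasCert

/-!
# Hauser–Wagner height, bonus, intricacy and slope on rows of the kangaroo atlas (computable twin)

Hauser and Wagner [cite: HauserWagner2014, §4–§6, §9] resolve the purely inseparable surface
`x^p + F(y,z) = 0` by point blow-ups using a local invariant
`i_a(f) = (intricacy, slope) = (height − bonus, slope)` attached to the class `f` of `F` in
`R/R^p` at a closed point `a`, a local flag (a smooth formal curve through `a`) and subordinate
coordinates `(y, z)` — the flag is `z = 0`, HW's `y` is the FREE variable, `z` the RIGID one.
All measures are read off the Newton polygon of the cleaned expansion `F(y,z)`; the invariant is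
the minimum / maximum over subordinate coordinate changes `(y, z) ↦ (y + φ(z), z)`.

This file is the computable twin, on the sparse list model `Poly` of
`Literature.AlgebraicGeometry.Resolution.KangarooAtlasCert`, of the COORDINATE-LEVEL measures
(those of a given expansion `F`), with the published definitions quoted in each docstring, and
kernel-checked rows (`decide`):

* `Height(F) = Degree_y(F) − Order_y(F)` where `(Degree_y F, ord_z F)` is the highest vertex of
  the Newton polygon (largest free component among the vertices = smallest free exponent on the
  lowest rigid face) [cite: HauserWagner2014, §4 p. 186];
* adjacency `Adj(F) ∈ {2, 1, 0}` (adjacent `ord_y F = 0`, close `= 1`, distant `≥ 2`), the bonus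
  `1 + δ | ε | 0` and the intricacy `Height − Bonus` [cite: HauserWagner2014, §4 p. 187]; HW leave
  `0 < ε < δ < 1` free — here the instance `ε = 1/3, δ = 2/3` scaled by `3` (an order embedding of
  HW's value set `ℕ_{δ,ε}` into `ℤ`): `intricacyKey = 3·Height − bonusKey`, `bonusKey ∈ {5, 1, 0}`;
* `Slope(F) = α₁ (β₂ − β₁)/(α₁ − α₂)` from the two highest vertices, `∞` for a quadrant
  [cite: HauserWagner2014, §4 p. 187], as a reduced pair `(num, den)`, `none = ∞`;
* `Width`, quasi-monomials (`Width = 1 ∧ ord_y F = 0`) [cite: HauserWagner2014, §6.1 (V)];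
* the second invariant's `Dorder = ord F − ord_y F − ord_z F`, `Dent = (α₁ − α₂, β₂ − β₁)` and
  `Defect` [cite: HauserWagner2014, §9.1];
* the moves: HW's translational / horizontal move `F*(y,z) = F(yz + tz, z)` followed by division by
  `z^p` is this model's `step` in the chart of the RIGID variable with translation `t` of the free
  one; the vertical move `F(y, yz)/y^p` is `step` in the chart of the free variable at the origin
  [cite: HauserWagner2014, §5 and Remark 8 (total transform; exceptional monomials are kept in `F`)];
* a sufficient CERTIFICATE `t1Cert` that the given coordinates realise the height (no subordinate
  change `y ↦ y + φ(z)` raises `ord_y`), by the first-obstruction count described at `t1Cert` — an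
  elementary sufficient condition used by the atlas, NOT a statement of [cite: HauserWagner2014].

Rows: [cite: HauserWagner2014, Remark 11] (`p = 2`, `F = y⁵z + y³z³ + y³z⁸`: `Height(F_d) = 2`,
`Degree_y(F*) = 3` after the translational move with `t = 1` — the sharpness example for Lemma 3);
Hauser's kangaroo path `x² + y⁷ + yz⁴` [cite: Hauser2010, §G] with flag `y = 0` (rigid `y`, free
`z`): the vector `(intricacyKey, slope)` reads `(7, 6) → (7, 2) → (6, 5) → (0, ∞)`, lexicographically
decreasing at every step INCLUDING the kangaroo step (shade `2 → 3`), where the transform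
`y⁶z³(1 + z²)` is a monomial times a unit (`Height = 0`); all four expansions pass `t1Cert`.

Indices: every measure takes the positions `rig` (flag variable) and `free` in the exponent list,
so rows can be stated in the letters of their source.  This is a CERTIFICATE of finitely many
computations and a typed transcription of definitions, not a theorem about resolution; the
coordinate-free invariant (minimum over all subordinate coordinates) is not computed here.
-/

namespace Literature.AlgebraicGeometry.Resolution.KangarooAtlasCert

namespace HauserWagner

/-- exponent of the `i`-th variable in a monomial. [folklore] -/
def expo (m : Mon) (i : ℕ) : ℕ := m.getD i 0

/-- minimum of a list of naturals (`0` on the empty list, a value callers never use). [folklore] -/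
def minList : List ℕ → ℕ
  | [] => 0
  | a :: rest => rest.foldl min a

/-- `ord_{y_i} F`: the least exponent of `y_i` in the support. [cite: HauserWagner2014, §4 p. 186] -/
def ordVar (P : Poly) (i : ℕ) : ℕ := minList (P.map fun t => expo t.1 i)

/-- HW's `Degree_y(F)` (free = `y`, rig = `z`): the free exponent `α₁` of the highest vertex
`(α₁, β₁)`, `β₁ = ord_z F`, i.e. the least free exponent on the lowest rigid face.
[cite: HauserWagner2014, §4 p. 186] -/
def degAlong (P : Poly) (rig free : ℕ) : ℕ :=
  minList ((P.filter fun t => expo t.1 rig = ordVar P rig).map fun t => expo t.1 free)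

/-- `Height(F) = Degree_y(F) − Order_y(F)` = order of `H(y, 0)` for `F = y^k z^n H` with `H` not divisible by `y`, `z`.
[cite: HauserWagner2014, §4 p. 186 and Remark 2] -/
def height (P : Poly) (rig free : ℕ) : ℕ := degAlong P rig free - ordVar P free

/-- `Width(F) = deg_z(F) − Order_z(F)` (the height with the roles of the variables exchanged).
[cite: HauserWagner2014, §6.1 (V)] -/
def width (P : Poly) (rig free : ℕ) : ℕ := degAlong P free rig - ordVar P rig

/-- HW's adjacency number `Adj(F)`: `2` adjacent (`ord_y F = 0`), `1` close (`ord_y F = 1`), `0` distant (`ord_y F ≥ 2`).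
[cite: HauserWagner2014, §4 p. 186 and §6.1] -/
def adj (P : Poly) (free : ℕ) : ℕ :=
  match ordVar P free with
  | 0 => 2
  | 1 => 1
  | _ => 0

/-- `3 · Bonus(F)` for the instance `ε = 1/3`, `δ = 2/3`: `1 + δ ↦ 5`, `ε ↦ 1`, `0 ↦ 0`.
[cite: HauserWagner2014, §4 p. 187 (Bonus)] -/
def bonusKey (P : Poly) (free : ℕ) : ℕ :=
  match adj P free with
  | 2 => 5
  | 1 => 1
  | _ => 0

/-- `3 · (Height(F) − Bonus(F))`, the scaled intricacy of the expansion `F`. [cite: HauserWagner2014, §4 p. 187] -/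
def intricacyKey (P : Poly) (rig free : ℕ) : ℤ := 3 * (height P rig free : ℤ) - (bonusKey P free : ℤ)

/-- quasi-monomial: adjacent with `Width(F) = 1` (resolved by line blow-ups, excluded from HW's Theorem 2).
[cite: HauserWagner2014, §6.1 (V) and Remark 12] -/
def isQuasiMonomial (P : Poly) (rig free : ℕ) : Bool := (width P rig free == 1) && (ordVar P free == 0)

/-- support points strictly below the highest vertex in the free direction, as `(free exponent, rigid exponent)`;
they lie strictly above it in the rigid direction. [folklore] -/
def lowerPoints (P : Poly) (rig free : ℕ) : List (ℕ × ℕ) :=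
  (P.filter fun t => expo t.1 free < degAlong P rig free).map fun t => (expo t.1 free, expo t.1 rig)

/-- the second highest vertex `(α₂, β₂)`: the far end of the steepest edge issuing from `(α₁, β₁)`, i.e. the point
minimising `(β − β₁)/(α₁ − α)` and, among those, with the largest `β`; `none` if the Newton polygon is a quadrant.
[cite: HauserWagner2014, §4 p. 186] -/
def secondVertex (P : Poly) (rig free : ℕ) : Option (ℕ × ℕ) :=
  let a1 := degAlong P rig free
  let b1 := ordVar P rig
  -- (β − β₁, α₁ − α) compared by cross-multiplication
  let better : ℕ × ℕ → ℕ × ℕ → Bool := fun q r =>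
    (q.2 - b1) * (a1 - r.1) < (r.2 - b1) * (a1 - q.1) ∨
      ((q.2 - b1) * (a1 - r.1) = (r.2 - b1) * (a1 - q.1) ∧ r.2 < q.2)
  match lowerPoints P rig free with
  | [] => none
  | q :: rest => some (rest.foldl (fun best r => if better r best then r else best) q)

/-- `Slope(F) = α₁ · (β₂ − β₁)/(α₁ − α₂)` as a reduced pair `(numerator, denominator)`; `none` = `∞` (quadrant).
[cite: HauserWagner2014, §4 p. 187] -/
def slope (P : Poly) (rig free : ℕ) : Option (ℕ × ℕ) :=
  let a1 := degAlong P rig free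
  let b1 := ordVar P rig
  (secondVertex P rig free).map fun v =>
    let n := a1 * (v.2 - b1)
    let d := a1 - v.1
    (n / Nat.gcd n d, d / Nat.gcd n d)

/-- `Dent(F) = (α₁ − α₂, β₂ − β₁)` (updent, indent); `none` for a quadrant. [cite: HauserWagner2014, §9.1] -/
def dent (P : Poly) (rig free : ℕ) : Option (ℕ × ℕ) :=
  (secondVertex P rig free).map fun v => (degAlong P rig free - v.1, v.2 - ordVar P rig)

/-- `Dorder(F) = ord(F) − ord_y(F) − ord_z(F)` = `ord H` for `F = y^m z^n H` with the maximal monomial factored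
(the atlas' `shade_mm`). [cite: HauserWagner2014, §9.1] -/
def dorder (P : Poly) (rig free : ℕ) : ℕ := ord P - ordVar P rig - ordVar P free

/-- `3 · Defect(F)`: with `g = (Degree_y F − ord_y F) − Dorder(F)`: `g = 0 ↦ 3·Bonus`; `g = 1 ↦ 3δ = 2` if adjacent else `0`;
`g ≥ 2 ↦ 0`. [cite: HauserWagner2014, §9.1 (Defect)] -/
def defectKey (P : Poly) (rig free : ℕ) : ℕ :=
  match height P rig free - dorder P rig free with
  | 0 => bonusKey P free
  | 1 => if adj P free = 2 then 2 else 0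
  | _ => 0

/-- `3 · (Dorder(F) − Defect(F))`, the scaled first component of HW's second invariant `j_a`. [cite: HauserWagner2014, §9.1] -/
def revdorderKey (P : Poly) (rig free : ℕ) : ℤ := 3 * (dorder P rig free : ℤ) - (defectKey P rig free : ℤ)

/-- lexicographic comparison of adjusted height vectors `(intricacy, slope)` of two expansions, `∞` largest.
[cite: HauserWagner2014, §4 p. 187 (i_a)] -/
def ivecLT (P Q : Poly) (rig free : ℕ) : Bool :=
  let i1 := intricacyKey P rig free
  let i2 := intricacyKey Q rig free
  let slopeLT : Option (ℕ × ℕ) → Option (ℕ × ℕ) → Bool := fun s t =>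
    match s, t with
    | some u, some v => u.1 * v.2 < v.1 * u.2
    | some _, none => true
    | none, _ => false
  (i1 < i2) || (i1 == i2 && slopeLT (slope P rig free) (slope Q rig free))

/-- HW's Lemma 1, `Height(F) ≤ deg_y(F) − 2 + Adj(F)`, evaluated on an expansion. [cite: HauserWagner2014, Lemma 1] -/
def lemma1Holds (P : Poly) (rig free : ℕ) : Bool := height P rig free + 2 ≤ degAlong P rig free + adj P free

/-- Sufficient certificate that NO subordinate change `y_free ↦ y_free + φ(y_rig)` (`φ(0) = 0`) raises `ord_free` of the
cleaned expansion, so that the given coordinates realise HW's height (`height_a = Height(F)`).  Write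
`F = Σ_k a_k(y_rig) y_free^k`, `o = ord_free F`, `A = ord a_o`.  Raising `ord_free` requires the new coefficient
`g_o = a_o + Σ_{k > o} C(k,o) a_k φ^{k−o}` to vanish (`p ∤ o`) or to be a `p`-th power (`p ∣ o`; then every exponent of
`a_o` is prime to `p` since `F` is cleaned), so `y_rig^A` must be cancelled by the sum; for `s = ord φ` the sum starts in
order `μ(s) = min {ord a_k + (k − o)s : k > o, C(k,o) ≢ 0 (mod p)}` (Lucas), and `s` is impossible when `μ(s) > A`, or when
`μ(s) < A` is attained by a single `k` with `p ∤ o` or `p ∤ μ(s)` (a lone surviving term).  `t1Cert = true` iff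
`Height(F) = 0` or every `s = 1, …, A` is impossible (`μ(s) > A` for `s > A`).  An elementary sufficient condition used by
the atlas (INVARIANTS-g6 §38); its failure certifies nothing. [folklore] -/
def t1Cert (p : ℕ) (P : Poly) (rig free : ℕ) : Bool :=
  let o := ordVar P free
  let A := degAlong P free rig          -- least rigid exponent on the face `free-exponent = o`
  let ks := (P.filter fun t => o < expo t.1 free ∧ Nat.choose (expo t.1 free) o % p ≠ 0).map
    fun t => (expo t.1 free, expo t.1 rig)
  let impossible : ℕ → Bool := fun s =>
    let orders := ks.map fun kb => kb.2 + (kb.1 - o) * s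
    let mu := minList orders
    let lone := ((ks.filter fun kb => kb.2 + (kb.1 - o) * s = mu).map fun kb => kb.1).eraseDups.length = 1
    orders.isEmpty || (A < mu) || (mu < A && lone && (o % p != 0 || mu % p != 0))
  (height P rig free == 0) || (List.range A).all fun s => impossible (s + 1)

/-- the states along a scripted path (stops at a failing step). [folklore] -/
def statesAlong (p q : ℕ) (s : State) : List (ℕ × List ℕ) → List State
  | [] => [s]
  | (j, b) :: rest =>
      match step p q s j b with
      | none => [s]
      | some s' => s :: statesAlong p q s' rest

/-- consecutive comparisons `ivecLT next current` along a list of expansions. [folklore] -/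
def dropsAlong (rig free : ℕ) : List Poly → List Bool
  | P :: Q :: rest => ivecLT Q P rig free :: dropsAlong rig free (Q :: rest)
  | _ => []

/-- order of the restriction to the flag hypersurface `y_rig = 0` of `H = F / (maximal monomial)` for any number of
variables: `min {Σ_{i ≠ rig} e_i : e ∈ supp F, e_rig = ord_rig F} − Σ_{i ≠ rig} ord_{y_i} F`.  For two variables this is
`Height(F)` [cite: HauserWagner2014, Remark 2]; for three it is the atlas' transplant `Height₃` (INVARIANTS-g6 §40, a
convention of the atlas, not a published invariant). [folklore] -/
def faceOrder (P : Poly) (rig m : ℕ) : ℕ :=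
  let others := (List.range m).filter fun i => i ≠ rig
  minList ((P.filter fun t => expo t.1 rig = ordVar P rig).map fun t => (others.map fun i => expo t.1 i).sum)
    - (others.map fun i => ordVar P i).sum

/-! ## Rows -/

/-- [cite: HauserWagner2014, Remark 11]: `p = 2`, `F = y⁵z + y³z³ + y³z⁸` in HW's letters (position `0` = `y` free,
position `1` = `z` rigid). -/
def rem11F : Poly := [([5, 1], 1), ([3, 3], 1), ([3, 8], 1)]
/-- its initial form `F_d = y⁵z + y³z³`, `d = 6`. [cite: HauserWagner2014, Remark 11] -/
def rem11Fd : Poly := [([5, 1], 1), ([3, 3], 1)]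

/-- `Height(F_d) = 2`. [cite: HauserWagner2014, Remark 11] -/
theorem rem11_height_Fd : height rem11Fd 1 0 = 2 := by decide

/-- `Degree_y(F*) = 3 = Height(F_d) + Parity(d)` for `F*(y,z) = F(yz + z, z)` (here divided by `z²`, which does not change
`Degree_y`): the move is `step` in the chart of `z` (position 1) with translation `1` of `y`. [cite: HauserWagner2014, Remark 11] -/
theorem rem11_degree_Fstar :
    ((step 2 2 ⟨rem11F, [0, 0]⟩ 1 [1, 0]).map fun s => degAlong s.F 1 0) = some 3 := by decide

/-- the measures of `F` itself: distant (`ord_y = 3`), `Height 2`, `Slope 5`, `Dorder 2`, `Dent (2, 2)`, Lemma 1 holds.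
[cite: HauserWagner2014, §4, §9.1, Lemma 1] -/
theorem rem11_measures :
    (adj rem11F 0, height rem11F 1 0, slope rem11F 1 0, dorder rem11F 1 0, dent rem11F 1 0, lemma1Holds rem11F 1 0)
      = (0, 2, some (5, 1), 2, some (2, 2), true) := by decide

/-- Hauser's kangaroo path [cite: Hauser2010, §G] read with the flag `y = 0` (position `0` rigid, position `1` = `z` free):
the expansions are `y⁷ + yz⁴`, `y⁵ + y³z⁴`, `y⁵z³ + y³z⁵`, `y⁶z³ + y⁶z⁵`. [cite: Hauser2010, §G] -/
theorem hauser_states :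
    (statesAlong 2 2 ⟨hauserF, [0, 0]⟩ hauserPath).map (fun s => s.F)
      = [hauserF, [([5, 0], 1), ([3, 4], 1)], [([5, 3], 1), ([3, 5], 1)], [([6, 3], 1), ([6, 5], 1)]] := by decide

/-- `(Height, intricacyKey, Slope)` along Hauser's path: `(4, 7, 6)`, `(4, 7, 2)`, `(2, 6, 5)`, `(0, 0, ∞)` — horizontal move
(height kept, slope drops by `α₁ = 4`), vertical move (height drops by `2`), translational move at the kangaroo point
(monomial times unit). [cite: HauserWagner2014, §4, §6] -/
theorem hauser_hw_table :
    (statesAlong 2 2 ⟨hauserF, [0, 0]⟩ hauserPath).map (fun s => (height s.F 0 1, intricacyKey s.F 0 1, slope s.F 0 1))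
      = [(4, 7, some (6, 1)), (4, 7, some (2, 1)), (2, 6, some (5, 1)), (0, 0, none)] := by decide

/-- the adjusted height vector decreases lexicographically at all three steps of Hauser's path, the kangaroo step included.
[cite: HauserWagner2014, Theorem 2 (i)] (an instance computed in given coordinates, see `hauser_t1`). -/
theorem hauser_hw_drops :
    dropsAlong 0 1 ((statesAlong 2 2 ⟨hauserF, [0, 0]⟩ hauserPath).map fun s => s.F) = [true, true, true] := by decide

/-- all four expansions of Hauser's path pass the realisation certificate `t1Cert` (given coordinates realise the height). [folklore] -/
theorem hauser_t1 :
    ((statesAlong 2 2 ⟨hauserF, [0, 0]⟩ hauserPath).map fun s => t1Cert 2 s.F 0 1) = [true, true, true, true] := by decide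

/-- second invariant along Hauser's path: `(Dorder, revdorderKey, Dent)` = `(4, 7, (4,6))`, `(2, 6, (4,2))`, `(2, 6, (2,2))`,
`(0, 0, ∞)`. [cite: HauserWagner2014, §9.1] -/
theorem hauser_second_invariant :
    (statesAlong 2 2 ⟨hauserF, [0, 0]⟩ hauserPath).map (fun s => (dorder s.F 0 1, revdorderKey s.F 0 1, dent s.F 0 1))
      = [(4, 7, some (4, 6)), (2, 6, some (4, 2)), (2, 6, some (2, 2)), (0, 0, none)] := by decide

/-- a quasi-monomial in HW's letters: `F = y³z² + z³` (`p = 2`) is adjacent with `Width = 1`; `y⁷ + yz⁴` read with `z` rigid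
is not. [cite: HauserWagner2014, §6.1 (V)] -/
theorem quasi_rows :
    (isQuasiMonomial [([3, 2], 1), ([0, 3], 1)] 1 0, isQuasiMonomial hauserF 0 1) = (true, false) := by decide

/-- the transplanted face order on the atlas' dimension-four row `x² + y² + z³ + w⁵` (`e8F = z³ + w⁵` on positions
`(y, z, w)`, see `KangarooAtlasCert.e8F`) with the flag `y = 0` (position `0`): `faceOrder = 3`. [folklore] -/
theorem e8_faceOrder : faceOrder e8F 0 3 = 3 := by decide

end HauserWagner

end Literature.AlgebraicGeometry.Resolution.KangarooAtlasCert
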